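/-
  SeedCheckerMomentLattice.lean — hsemireg-c5c8-1, generation 34 (file version v34).  Mathlib-only, sorry-free.
  Token: line stmt-HodgeConjecture-18881 Cruxes/BlochSeedDiscOne/Lines/birth.lean 814a6a70c14e831a stub_rung_pad4_seedAt
  (the stub is neither restated nor weakened; this file does not import the route).

  HONEST FRAMING.  Nothing here is proved toward HC / HC_CM / HC_AV / ladder rung №4 / stmt-26512 / stmt-18881 / H2.
  This seat produces EVIDENCE and TYPED FILES, not rungs.  The file records the ARITHMETIC CORES of the moment-lattice
  rows «INT-8 / MU-LATTICE / WINDOW / LETTERS» of the C5–C8 seed checker (memo SEED-CHECKER-C5C8-c5c8-1-g34.md):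

  * §1  h(h-1)⋯(h-7) = 8!·C(h,8) and h⁸ = 8!·C(h,8) + R₇(h), R₇ ∈ ℤ[h] explicit, R₇(0) = 0 (and the degree-7 analogue).
  * §2  INT-8: for an integer net-mass function F on finitely many integer (ℕ) scales, the vanishing of the power
        moments P(1..7) forces P(8) = 8!·B₈ with B₈ = Σ F_h C(h,8) ∈ ℤ, hence 8! ∣ P(8); with only P(1..6) = 0:
        P(7) = 7!·B₇ and P(8) = 8!·B₈ + 28·P(7).  Sharpness: the eighth difference pattern attains P(8) = 8!.
  * §3  Consequences used by the checker, as pure arithmetic: 140·P(8) = |μ|² (the rank-4 locally-free class shape of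
        hsemireg-semihom-2 g15 §4.1, a HYPOTHESIS here) and 8! ∣ P(8) give 5 644 800 ∣ |μ|²; the direction-free cap
        law |μ| ≤ 2(T+2) (g15 §3.2, a HYPOTHESIS here) then gives T ≥ 1186; the directional instances w = (2,1),
        (1,1) give D ≥ 1256 resp. 1257 (D = top P-scale − bottom N-scale, T ≥ D + 2); soft letters bound 2376.
  * §4  Exact lattice descent in ℕ (elementary: −1 is a non-residue mod 3 and mod 7, squares mod 4):
        5 644 800 ∣ x² + y² > 0 ⟹ x = 336u, y = 336v, 50 ∣ u² + v² > 0; hence |Re μ| + |Im μ| ≥ 2688 (sharp: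
        2352 + 336), the norm-5 644 800 shapes are exactly {2352+336i, 336+2352i, 1680+1680i} up to signs, and the
        three cap-law instances (w = (±2,±1), (±1,±2), (±1,±1); κ = 1, 1, 2/3; G = 2, 2, 1 — HYPOTHESES) force
        D ≥ 1256, i.e. T ≥ 1258 scales for every nonzero lattice μ.

  The (A1) ⟺ P(0..6) = 0 dictionary (g14 §7′), the LF shape (g15 §4.1) and the cap law (g15 §3.2) are NOT proved
  here: they enter §3 only as named hypotheses of arithmetic lemmas.
-/
import Mathlib

set_option linter.dupNamespace false

namespace Summit.HodgeConjecture.HodgeConjecture.Cruxes.BlochSeedDiscOne.SeedChecker.MomentLattice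

open Finset

/-! ## §1 Falling factorials of length 7 and 8 over ℤ -/

theorem descPochhammer_seven_eval (x : ℤ) :
    (descPochhammer ℤ 7).eval x =
      x * (x - 1) * (x - 2) * (x - 3) * (x - 4) * (x - 5) * (x - 6) := by
  simp [descPochhammer_succ_eval]

theorem descPochhammer_eight_eval (x : ℤ) :
    (descPochhammer ℤ 8).eval x =
      x * (x - 1) * (x - 2) * (x - 3) * (x - 4) * (x - 5) * (x - 6) * (x - 7) := by
  simp [descPochhammer_succ_eval]

theorem factorial_seven : Nat.factorial 7 = 5040 := by decide

theorem factorial_eight : Nat.factorial 8 = 40320 := by decide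

/-- `h(h-1)⋯(h-6) = 7!·C(h,7)` over ℤ, for every natural scale `h`. -/
theorem fallingSeven_eq (h : ℕ) :
    (h : ℤ) * ((h : ℤ) - 1) * ((h : ℤ) - 2) * ((h : ℤ) - 3) * ((h : ℤ) - 4) * ((h : ℤ) - 5) *
        ((h : ℤ) - 6) = 5040 * (h.choose 7 : ℤ) := by
  have e := descPochhammer_eval_eq_descFactorial ℤ h 7
  rw [descPochhammer_seven_eval, Nat.descFactorial_eq_factorial_mul_choose, factorial_seven] at e
  rw [e]; push_cast; ring

/-- `h(h-1)⋯(h-7) = 8!·C(h,8)` over ℤ, for every natural scale `h`. -/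
theorem fallingEight_eq (h : ℕ) :
    (h : ℤ) * ((h : ℤ) - 1) * ((h : ℤ) - 2) * ((h : ℤ) - 3) * ((h : ℤ) - 4) * ((h : ℤ) - 5) *
        ((h : ℤ) - 6) * ((h : ℤ) - 7) = 40320 * (h.choose 8 : ℤ) := by
  have e := descPochhammer_eval_eq_descFactorial ℤ h 8
  rw [descPochhammer_eight_eval, Nat.descFactorial_eq_factorial_mul_choose, factorial_eight] at e
  rw [e]; push_cast; ring

/-- `h⁷ = 7!·C(h,7) + R₆(h)` with the explicit integer remainder (unsigned Stirling numbers of the first kind). -/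
theorem pow_seven_eq (h : ℕ) :
    (h : ℤ) ^ 7 = 5040 * (h.choose 7 : ℤ) + (21 * (h : ℤ) ^ 6 - 175 * (h : ℤ) ^ 5 + 735 * (h : ℤ) ^ 4
      - 1624 * (h : ℤ) ^ 3 + 1764 * (h : ℤ) ^ 2 - 720 * (h : ℤ)) := by
  rw [← fallingSeven_eq]; ring

/-- `h⁸ = 8!·C(h,8) + R₇(h)` with the explicit integer remainder, `R₇(0) = 0`. -/
theorem pow_eight_eq (h : ℕ) :
    (h : ℤ) ^ 8 = 40320 * (h.choose 8 : ℤ) + (28 * (h : ℤ) ^ 7 - 322 * (h : ℤ) ^ 6 + 1960 * (h : ℤ) ^ 5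
      - 6769 * (h : ℤ) ^ 4 + 13132 * (h : ℤ) ^ 3 - 13068 * (h : ℤ) ^ 2 + 5040 * (h : ℤ)) := by
  rw [← fallingEight_eq]; ring

/-- `h⁸ = 8!·C(h,8) + 28·7!·C(h,7) + (degree ≤ 6, no constant term)`. -/
theorem pow_eight_eq' (h : ℕ) :
    (h : ℤ) ^ 8 = 40320 * (h.choose 8 : ℤ) + 28 * (5040 * (h.choose 7 : ℤ))
      + (266 * (h : ℤ) ^ 6 - 2940 * (h : ℤ) ^ 5 + 13811 * (h : ℤ) ^ 4 - 32340 * (h : ℤ) ^ 3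
        + 36324 * (h : ℤ) ^ 2 - 15120 * (h : ℤ)) := by
  rw [← fallingEight_eq, ← fallingSeven_eq]; ring

/-! ## §2 INT-8: vanishing low moments force `8! ∣ P(8)` -/

/-- The `j`-th power moment `P(j) = Σ_h F_h h^j` of a net-mass function `F` (N minus P letter counts per scale)
on a finite set `s` of natural scales. -/
def moment (s : Finset ℕ) (F : ℕ → ℤ) (j : ℕ) : ℤ := ∑ h ∈ s, F h * (h : ℤ) ^ j

/-- The binomial moment `B₇ = Σ_h F_h C(h,7)` (an integer for an integer design). -/
def binomMomentSeven (s : Finset ℕ) (F : ℕ → ℤ) : ℤ := ∑ h ∈ s, F h * (h.choose 7 : ℤ)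

/-- The binomial moment `B₈ = Σ_h F_h C(h,8)` (an integer for an integer design). -/
def binomMomentEight (s : Finset ℕ) (F : ℕ → ℤ) : ℤ := ∑ h ∈ s, F h * (h.choose 8 : ℤ)

theorem moment_seven_expand (s : Finset ℕ) (F : ℕ → ℤ) :
    moment s F 7 = 5040 * binomMomentSeven s F + (21 * moment s F 6 - 175 * moment s F 5
      + 735 * moment s F 4 - 1624 * moment s F 3 + 1764 * moment s F 2 - 720 * moment s F 1) := by
  simp only [moment, binomMomentSeven, Finset.mul_sum, ← Finset.sum_add_distrib, ← Finset.sum_sub_distrib]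
  refine Finset.sum_congr rfl (fun h _ => ?_)
  rw [pow_seven_eq h]; ring

theorem moment_eight_expand (s : Finset ℕ) (F : ℕ → ℤ) :
    moment s F 8 = 40320 * binomMomentEight s F + (28 * moment s F 7 - 322 * moment s F 6
      + 1960 * moment s F 5 - 6769 * moment s F 4 + 13132 * moment s F 3 - 13068 * moment s F 2
      + 5040 * moment s F 1) := by
  simp only [moment, binomMomentEight, Finset.mul_sum, ← Finset.sum_add_distrib, ← Finset.sum_sub_distrib]
  refine Finset.sum_congr rfl (fun h _ => ?_)
  rw [pow_eight_eq h]; ring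

theorem moment_eight_expand' (s : Finset ℕ) (F : ℕ → ℤ) :
    moment s F 8 = 40320 * binomMomentEight s F + 28 * (5040 * binomMomentSeven s F)
      + (266 * moment s F 6 - 2940 * moment s F 5 + 13811 * moment s F 4 - 32340 * moment s F 3
        + 36324 * moment s F 2 - 15120 * moment s F 1) := by
  simp only [moment, binomMomentEight, binomMomentSeven, Finset.mul_sum, ← Finset.sum_add_distrib,
    ← Finset.sum_sub_distrib]
  refine Finset.sum_congr rfl (fun h _ => ?_)
  rw [pow_eight_eq' h]; ring

/-- **INT-7.**  `P(1) = … = P(6) = 0` forces `P(7) = 7!·B₇`. -/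
theorem moment_seven_eq (s : Finset ℕ) (F : ℕ → ℤ)
    (hmom : ∀ j, 1 ≤ j → j ≤ 6 → moment s F j = 0) :
    moment s F 7 = 5040 * binomMomentSeven s F := by
  rw [moment_seven_expand, hmom 1 (by norm_num) (by norm_num), hmom 2 (by norm_num) (by norm_num),
    hmom 3 (by norm_num) (by norm_num), hmom 4 (by norm_num) (by norm_num), hmom 5 (by norm_num) (by norm_num),
    hmom 6 (by norm_num) (by norm_num)]
  ring

/-- `P(1) = … = P(6) = 0` forces `P(8) = 8!·B₈ + 28·P(7)` (the form used when a design carries P(7) ≠ 0). -/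
theorem moment_eight_eq_of_six (s : Finset ℕ) (F : ℕ → ℤ)
    (hmom : ∀ j, 1 ≤ j → j ≤ 6 → moment s F j = 0) :
    moment s F 8 = 40320 * binomMomentEight s F + 28 * moment s F 7 := by
  rw [moment_seven_eq s F hmom, moment_eight_expand', hmom 1 (by norm_num) (by norm_num),
    hmom 2 (by norm_num) (by norm_num), hmom 3 (by norm_num) (by norm_num), hmom 4 (by norm_num) (by norm_num),
    hmom 5 (by norm_num) (by norm_num), hmom 6 (by norm_num) (by norm_num)]
  ring

/-- **INT-8.**  `P(1) = … = P(7) = 0` forces `P(8) = 8!·B₈`; `P(0)` is not needed. -/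
theorem moment_eight_eq (s : Finset ℕ) (F : ℕ → ℤ)
    (hmom : ∀ j, 1 ≤ j → j ≤ 7 → moment s F j = 0) :
    moment s F 8 = 40320 * binomMomentEight s F := by
  rw [moment_eight_expand, hmom 1 (by norm_num) (by norm_num), hmom 2 (by norm_num) (by norm_num),
    hmom 3 (by norm_num) (by norm_num), hmom 4 (by norm_num) (by norm_num), hmom 5 (by norm_num) (by norm_num),
    hmom 6 (by norm_num) (by norm_num), hmom 7 (by norm_num) (by norm_num)]
  ring

/-- **INT-8, divisibility form.** -/
theorem factorialEight_dvd_moment_eight (s : Finset ℕ) (F : ℕ → ℤ)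
    (hmom : ∀ j, 1 ≤ j → j ≤ 7 → moment s F j = 0) :
    (40320 : ℤ) ∣ moment s F 8 :=
  ⟨binomMomentEight s F, moment_eight_eq s F hmom⟩

/-- **INT-7, divisibility form.** -/
theorem factorialSeven_dvd_moment_seven (s : Finset ℕ) (F : ℕ → ℤ)
    (hmom : ∀ j, 1 ≤ j → j ≤ 6 → moment s F j = 0) :
    (5040 : ℤ) ∣ moment s F 7 :=
  ⟨binomMomentSeven s F, moment_seven_eq s F hmom⟩

/-- Sharpness: the eighth finite-difference pattern `F_h = (-1)^h C(8,h)` on scales `0..8` has `P(8) = 8!`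
(all lower moments vanish; here only the value of `P(8)` is recorded). -/
theorem eighthDifference_moment_eight :
    (∑ h ∈ Finset.range 9, ((-1 : ℤ) ^ h * (Nat.choose 8 h : ℤ)) * (h : ℤ) ^ 8) = 40320 := by
  simp only [Finset.sum_range_succ, Finset.sum_range_zero]
  norm_num [Nat.choose]

theorem eighthDifference_moment_low (j : ℕ) (hj : j ≤ 7) :
    (∑ h ∈ Finset.range 9, ((-1 : ℤ) ^ h * (Nat.choose 8 h : ℤ)) * (h : ℤ) ^ j) = 0 := by
  interval_cases j <;> simp only [Finset.sum_range_succ, Finset.sum_range_zero] <;> norm_num [Nat.choose]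

/-! ## §3 Arithmetic consequences used by the checker rows (class-shape and cap law enter as hypotheses) -/

theorem lattice_const :
    (5644800 : ℤ) = 140 * 40320 ∧ (5644800 : ℤ) = 2 ^ 9 * 3 ^ 2 * 5 ^ 2 * 7 ^ 2 := by norm_num

/-- **MU-LATTICE.**  LF class shape `140·P(8) = |μ|²` and INT-8 `8! ∣ P(8)` give `5 644 800 ∣ |μ|²`. -/
theorem weilNorm_dvd (P8 m2 : ℤ) (hLF : 140 * P8 = m2) (hI : (40320 : ℤ) ∣ P8) :
    (5644800 : ℤ) ∣ m2 := by
  obtain ⟨B, hB⟩ := hI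
  exact ⟨B, by subst hB; linarith⟩

/-- Same, with the multiplier named: `|μ|² = 5 644 800·B₈`, so `B₈ ≥ 1` for `μ ≠ 0`. -/
theorem weilNorm_eq (P8 B m2 : ℤ) (hLF : 140 * P8 = m2) (hI : P8 = 40320 * B) :
    m2 = 5644800 * B := by
  subst hI; linarith

theorem binomMoment_pos (B m2 : ℤ) (h : m2 = 5644800 * B) (hpos : 0 < m2) : 1 ≤ B := by
  subst h; omega

/-- The two `k = 1` lattice shapes `336·(7+i)` and `1680·(1+i)` lie on the sphere `|μ|² = 5 644 800`,
and g15/g16's classes `28+14i, 42+14i, 56+28i, 70, 56+42i` (|μ|² = 980, 1960, 3920, 4900, 4900) do not lie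
in `5 644 800·ℤ`. -/
theorem shapes_norm :
    (2352 : ℤ) ^ 2 + 336 ^ 2 = 5644800 ∧ (1680 : ℤ) ^ 2 + 1680 ^ 2 = 5644800 ∧
    ¬ (5644800 : ℤ) ∣ 28 ^ 2 + 14 ^ 2 ∧ ¬ (5644800 : ℤ) ∣ 42 ^ 2 + 14 ^ 2 ∧
    ¬ (5644800 : ℤ) ∣ 56 ^ 2 + 28 ^ 2 ∧ ¬ (5644800 : ℤ) ∣ 70 ^ 2 + 0 ^ 2 ∧
    ¬ (5644800 : ℤ) ∣ 56 ^ 2 + 42 ^ 2 := by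
  norm_num

/-- μ₀ = 28 + 14i would need `P(8) = 7`, which is not a multiple of 8!: no INTEGER design of the family has class μ₀. -/
theorem mu0_not_int8 : ¬ (40320 : ℤ) ∣ 7 := by norm_num

/-- **WINDOW (direction-free).**  With `5 644 800 ∣ |μ|²`, `μ ≠ 0` and the direction-free cap law
`|μ| ≤ m(T+2)/2 = 2(T+2)` (m = 4) in squared form, the number of scales satisfies `T ≥ 1186`. -/
theorem window_directionFree (m2 : ℤ) (T : ℕ) (hlat : (5644800 : ℤ) ∣ m2) (hpos : 0 < m2)
    (hcap : m2 ≤ (2 * ((T : ℤ) + 2)) ^ 2) : 1186 ≤ T := by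
  obtain ⟨k, hk⟩ := hlat
  have hk1 : 1 ≤ k := by subst hk; omega
  have h1 : (5644800 : ℤ) ≤ (2 * ((T : ℤ) + 2)) ^ 2 := by subst hk; nlinarith
  by_contra hT
  push Not at hT
  have hT' : (T : ℤ) + 2 ≤ 1187 := by
    have : T ≤ 1185 := Nat.lt_succ_iff.mp hT
    omega
  have h0 : (0 : ℤ) ≤ 2 * ((T : ℤ) + 2) := by positivity
  have h2 : (2 * ((T : ℤ) + 2)) ^ 2 ≤ (2 * 1187) ^ 2 := by nlinarith
  norm_num at h2
  linarith

/-- **WINDOW, shape 336(7+i), functional w = (2,1).**  Cap law (g15 §3.2) `W(μ) ≤ m[κ·D + 2G]` with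
`W(μ) = 2·2352 + 336 = 5040`, `κ = 1`, `G = 2`, `m = 4`, `D` = top P-scale − bottom N-scale (so `T ≥ D + 2`):
`D ≥ 1256`, i.e. `T ≥ 1258`.  (The functional (7,1): W = 16800, κ = 7/2, G = 7 only gives D ≥ 1196.) -/
theorem window_shape_7_1 (D : ℕ) (h : (5040 : ℤ) ≤ 4 * (1 * (D : ℤ) + 2 * 2)) : 1256 ≤ D := by
  omega

/-- **WINDOW, shape 1680(1+i), functional w = (1,1).**  `W(μ) = 3360`, `κ = 2/3`, `G = 1`, `m = 4`:
`D ≥ 1257`, i.e. `T ≥ 1259`.  (Tripled to clear κ.) -/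
theorem window_shape_1_1 (D : ℕ) (h : (3 : ℤ) * 3360 ≤ 4 * (2 * (D : ℤ) + 3 * (2 * 1))) : 1257 ≤ D := by
  omega

/-- **LETTERS (soft).**  `|Re μ| + |Im μ| ≥ 2376` as soon as `|μ|² ≥ 5 644 800`; the letter count of a design is
`≥ Σ_c |net_c| ≥ |Re μ| + |Im μ|`.  (Exact lattice minimum 2688: script enumeration, not here.) -/
theorem letters_soft (a b : ℤ) (h : (5644800 : ℤ) ≤ a ^ 2 + b ^ 2) : 2376 ≤ |a| + |b| := by
  have hx := abs_nonneg a
  have hy := abs_nonneg b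
  have hxa : |a| ^ 2 = a ^ 2 := sq_abs a
  have hyb : |b| ^ 2 = b ^ 2 := sq_abs b
  by_contra hlt
  push Not at hlt
  have hle : |a| + |b| ≤ 2375 := by
    have := Int.lt_iff_add_one_le.mp hlt
    linarith
  have hsq : (|a| + |b|) * (|a| + |b|) ≤ 2375 * 2375 :=
    mul_self_le_mul_self (by positivity) hle
  nlinarith [mul_nonneg hx hy]

/-- Net class masses bound the letter count: `n + p ≥ |n - p|` cellwise, summed. -/
theorem letters_ge_net (n p : ℤ) (hn : 0 ≤ n) (hp : 0 ≤ p) : |n - p| ≤ n + p := by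
  rw [abs_le]; constructor <;> linarith

/-- `|Re μ| + |Im μ| ≤ Σ_c |net_c|` for `μ = (net₀ - net₂) + i (net₁ - net₃)`. -/
theorem reim_le_nets (n0 n1 n2 n3 : ℤ) :
    |n0 - n2| + |n1 - n3| ≤ |n0| + |n1| + |n2| + |n3| := by
  have h1 := abs_sub n0 n2
  have h2 := abs_sub n1 n3
  linarith

/-! ## §4 Exact lattice descent (ℕ): `5 644 800 ∣ x² + y²` forces `336 ∣ x, y`; letters 2688, shapes, window 1256 -/

/-- Squares mod 4: `4 ∣ x² + y²` forces both even. -/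
theorem two_dvd_of_four_dvd (x y : ℕ) (h : 4 ∣ x ^ 2 + y ^ 2) : 2 ∣ x ∧ 2 ∣ y := by
  obtain ⟨q, r, hr, rfl⟩ : ∃ q r, r < 4 ∧ x = 4 * q + r :=
    ⟨x / 4, x % 4, Nat.mod_lt _ (by norm_num), (Nat.div_add_mod x 4).symm⟩
  obtain ⟨q', r', hr', rfl⟩ : ∃ q r, r < 4 ∧ y = 4 * q + r :=
    ⟨y / 4, y % 4, Nat.mod_lt _ (by norm_num), (Nat.div_add_mod y 4).symm⟩
  interval_cases r <;> interval_cases r' <;> ring_nf at h ⊢ <;> omega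

/-- `−1` is a non-residue mod 3: `3 ∣ x² + y²` forces `3 ∣ x` and `3 ∣ y`. -/
theorem three_dvd_of_three_dvd (x y : ℕ) (h : 3 ∣ x ^ 2 + y ^ 2) : 3 ∣ x ∧ 3 ∣ y := by
  obtain ⟨q, r, hr, rfl⟩ : ∃ q r, r < 3 ∧ x = 3 * q + r :=
    ⟨x / 3, x % 3, Nat.mod_lt _ (by norm_num), (Nat.div_add_mod x 3).symm⟩
  obtain ⟨q', r', hr', rfl⟩ : ∃ q r, r < 3 ∧ y = 3 * q + r :=
    ⟨y / 3, y % 3, Nat.mod_lt _ (by norm_num), (Nat.div_add_mod y 3).symm⟩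
  interval_cases r <;> interval_cases r' <;> ring_nf at h ⊢ <;> omega

/-- `−1` is a non-residue mod 7: `7 ∣ x² + y²` forces `7 ∣ x` and `7 ∣ y`. -/
theorem seven_dvd_of_seven_dvd (x y : ℕ) (h : 7 ∣ x ^ 2 + y ^ 2) : 7 ∣ x ∧ 7 ∣ y := by
  obtain ⟨q, r, hr, rfl⟩ : ∃ q r, r < 7 ∧ x = 7 * q + r :=
    ⟨x / 7, x % 7, Nat.mod_lt _ (by norm_num), (Nat.div_add_mod x 7).symm⟩
  obtain ⟨q', r', hr', rfl⟩ : ∃ q r, r < 7 ∧ y = 7 * q + r :=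
    ⟨y / 7, y % 7, Nat.mod_lt _ (by norm_num), (Nat.div_add_mod y 7).symm⟩
  interval_cases r <;> interval_cases r' <;> ring_nf at h ⊢ <;> omega

/-- One 2-adic descent step: `4N ∣ x² + y²` ⟹ `x = 2x'`, `y = 2y'`, `N ∣ x'² + y'²`. -/
theorem half_step (N x y : ℕ) (h : 4 * N ∣ x ^ 2 + y ^ 2) :
    ∃ x' y', x = 2 * x' ∧ y = 2 * y' ∧ N ∣ x' ^ 2 + y' ^ 2 := by
  obtain ⟨⟨x', rfl⟩, ⟨y', rfl⟩⟩ := two_dvd_of_four_dvd x y (dvd_trans (Dvd.intro N rfl) h)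
  refine ⟨x', y', rfl, rfl, ?_⟩
  have e : (2 * x') ^ 2 + (2 * y') ^ 2 = 4 * (x' ^ 2 + y' ^ 2) := by ring
  rw [e] at h
  exact (mul_dvd_mul_iff_left (by norm_num : (4 : ℕ) ≠ 0)).mp h

/-- One 3-adic step: `9N ∣ x² + y²` ⟹ `x = 3x'`, `y = 3y'`, `N ∣ x'² + y'²`. -/
theorem third_step (N x y : ℕ) (h : 9 * N ∣ x ^ 2 + y ^ 2) :
    ∃ x' y', x = 3 * x' ∧ y = 3 * y' ∧ N ∣ x' ^ 2 + y' ^ 2 := by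
  obtain ⟨⟨x', rfl⟩, ⟨y', rfl⟩⟩ := three_dvd_of_three_dvd x y (dvd_trans (Dvd.intro (3 * N) (by ring)) h)
  refine ⟨x', y', rfl, rfl, ?_⟩
  have e : (3 * x') ^ 2 + (3 * y') ^ 2 = 9 * (x' ^ 2 + y' ^ 2) := by ring
  rw [e] at h
  exact (mul_dvd_mul_iff_left (by norm_num : (9 : ℕ) ≠ 0)).mp h

/-- One 7-adic step: `49N ∣ x² + y²` ⟹ `x = 7x'`, `y = 7y'`, `N ∣ x'² + y'²`. -/
theorem seventh_step (N x y : ℕ) (h : 49 * N ∣ x ^ 2 + y ^ 2) :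
    ∃ x' y', x = 7 * x' ∧ y = 7 * y' ∧ N ∣ x' ^ 2 + y' ^ 2 := by
  obtain ⟨⟨x', rfl⟩, ⟨y', rfl⟩⟩ := seven_dvd_of_seven_dvd x y (dvd_trans (Dvd.intro (7 * N) (by ring)) h)
  refine ⟨x', y', rfl, rfl, ?_⟩
  have e : (7 * x') ^ 2 + (7 * y') ^ 2 = 49 * (x' ^ 2 + y' ^ 2) := by ring
  rw [e] at h
  exact (mul_dvd_mul_iff_left (by norm_num : (49 : ℕ) ≠ 0)).mp h

/-- **LATTICE DESCENT.**  `5 644 800 = 2⁹·3²·5²·7² ∣ x² + y²` with `x² + y² > 0` forces `x = 336u`, `y = 336v`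
with `50 ∣ u² + v² > 0` (so `μ ∈ 336·ℤ[i]` with `N(μ/336) ∈ 50ℤ`, matching `μ ∈ 336(1+i){5,(2±i)²}ℤ[i]`). -/
theorem lattice_descent (x y : ℕ) (h : 5644800 ∣ x ^ 2 + y ^ 2) (hpos : 0 < x ^ 2 + y ^ 2) :
    ∃ u v : ℕ, x = 336 * u ∧ y = 336 * v ∧ 50 ∣ u ^ 2 + v ^ 2 ∧ 0 < u ^ 2 + v ^ 2 := by
  obtain ⟨x1, y1, rfl, rfl, h1⟩ := third_step 627200 x y (by simpa using h)
  obtain ⟨x2, y2, rfl, rfl, h2⟩ := seventh_step 12800 x1 y1 (by simpa using h1)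
  obtain ⟨x3, y3, rfl, rfl, h3⟩ := half_step 3200 x2 y2 (by simpa using h2)
  obtain ⟨x4, y4, rfl, rfl, h4⟩ := half_step 800 x3 y3 (by simpa using h3)
  obtain ⟨x5, y5, rfl, rfl, h5⟩ := half_step 200 x4 y4 (by simpa using h4)
  obtain ⟨u, v, rfl, rfl, h6⟩ := half_step 50 x5 y5 (by simpa using h5)
  refine ⟨u, v, by ring, by ring, h6, ?_⟩
  by_contra h0
  push Not at h0
  have hu : u = 0 := by nlinarith
  have hv : v = 0 := by nlinarith
  subst hu; subst hv
  simp at hpos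

/-- **LETTERS (exact, ℕ form).**  `x = |Re μ|`, `y = |Im μ|`: `5 644 800 ∣ x² + y² > 0 ⟹ x + y ≥ 2688`
(sharp: `2352 + 336`).  The tower letter count is `≥ Σ_c |net_c| ≥ |Re μ| + |Im μ|`. -/
theorem letters_exact_nat (x y : ℕ) (h : 5644800 ∣ x ^ 2 + y ^ 2) (hpos : 0 < x ^ 2 + y ^ 2) :
    2688 ≤ x + y := by
  obtain ⟨u, v, rfl, rfl, h50, hp⟩ := lattice_descent x y h hpos
  have h50' : 50 ≤ u ^ 2 + v ^ 2 := Nat.le_of_dvd hp h50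
  have hs : 8 ≤ u + v := by
    by_contra hc
    have h7 : u + v ≤ 7 := by omega
    have hm : (u + v) * (u + v) ≤ 7 * 7 := Nat.mul_le_mul h7 h7
    nlinarith [hm, h50']
  omega

/-- **LETTERS (exact, ℤ form).**  `5 644 800 ∣ |μ|²`, `μ ≠ 0` ⟹ `|Re μ| + |Im μ| ≥ 2688`. -/
theorem letters_exact (a b : ℤ) (hlat : (5644800 : ℤ) ∣ a ^ 2 + b ^ 2) (hne : a ^ 2 + b ^ 2 ≠ 0) :
    2688 ≤ |a| + |b| := by
  have hsq : ((a.natAbs ^ 2 + b.natAbs ^ 2 : ℕ) : ℤ) = a ^ 2 + b ^ 2 := by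
    push_cast
    rw [sq_abs, sq_abs]
  have h1 : 5644800 ∣ a.natAbs ^ 2 + b.natAbs ^ 2 := by
    have := hlat
    rw [← hsq] at this
    exact_mod_cast this
  have h2 : 0 < a.natAbs ^ 2 + b.natAbs ^ 2 := by
    by_contra h0
    push Not at h0
    have hz : a.natAbs ^ 2 + b.natAbs ^ 2 = 0 := by omega
    apply hne
    rw [← hsq, hz]
    simp
  have h3 := letters_exact_nat _ _ h1 h2
  have ha : ((a.natAbs : ℕ) : ℤ) = |a| := Int.natCast_natAbs a
  have hb : ((b.natAbs : ℕ) : ℤ) = |b| := Int.natCast_natAbs b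
  rw [← ha, ← hb]
  exact_mod_cast h3

/-- **SHAPES at the lattice minimum.**  `x² + y² = 5 644 800` in ℕ ⟺ `(x,y) ∈ {(2352,336),(336,2352),(1680,1680)}`,
i.e. `μ ∈ {336(7±i), 336(1±7i), 1680(±1±i)}·(signs)`: the only Weil net-class vectors of an integer rank-4
locally-free one-orbit tower design with `P(8) = 8!` (k = 1). -/
theorem shapes_k1 (x y : ℕ) (h : x ^ 2 + y ^ 2 = 5644800) :
    (x = 2352 ∧ y = 336) ∨ (x = 336 ∧ y = 2352) ∨ (x = 1680 ∧ y = 1680) := by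
  obtain ⟨u, v, rfl, rfl, -, -⟩ := lattice_descent x y (by rw [h]) (by omega)
  have huv : u * u + v * v = 50 := by nlinarith [h]
  have hu : u ≤ 7 := by nlinarith
  have hv : v ≤ 7 := by nlinarith
  interval_cases u <;> interval_cases v <;> omega

/-- **WINDOW (exact).**  The three cap-law instances, for `x = |Re μ|`, `y = |Im μ|` (ℕ) and `D` = top P-scale −
bottom N-scale, are g15 §3.2 `W_w(μ) ≤ m[κ_w·D + 2G_w]`, `m = 4`, at the functionals `w = (2·sgn Re μ, sgn Im μ)`,
`(sgn Re μ, 2·sgn Im μ)` (κ = 1, G = 2) and `(sgn Re μ, sgn Im μ)` (κ = 2/3, G = 1; tripled) — HYPOTHESES `c1 c2 c3`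
(the cap law is the pencil / LP-dual statement of hsemireg-semihom-2 g15, not proved here).  Every nonzero lattice
vector (`5 644 800 ∣ x² + y² > 0`) subject to them needs `D ≥ 1256`, i.e. `T ≥ D + 2 ≥ 1258` scales (`≥ 1259` with
the Chern–Hall top rule).  The minimum is attained by the shape `2352 + 336i` with `w = (2,1)`; `1680(1+i)` needs
`D ≥ 1257`; norms `≥ 2·5 644 800` need `D ≥ 1340`. -/
theorem window_exact (x y : ℕ) (D : ℤ) (h : 5644800 ∣ x ^ 2 + y ^ 2) (hpos : 0 < x ^ 2 + y ^ 2)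
    (c1 : 2 * (x : ℤ) + y ≤ 4 * (1 * D + 2 * 2)) (c2 : (x : ℤ) + 2 * y ≤ 4 * (1 * D + 2 * 2))
    (c3 : 3 * ((x : ℤ) + y) ≤ 4 * (2 * D + 3 * (2 * 1))) : 1256 ≤ D := by
  obtain ⟨u, v, rfl, rfl, h50, hp⟩ := lattice_descent x y h hpos
  push_cast at c1 c2 c3
  have h50' : 50 ≤ u ^ 2 + v ^ 2 := Nat.le_of_dvd hp h50
  by_cases hk : u ^ 2 + v ^ 2 = 50
  · -- k = 1: the three shapes
    have huv : u * u + v * v = 50 := by nlinarith [hk]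
    have hu : u ≤ 7 := by nlinarith
    have hv : v ≤ 7 := by nlinarith
    interval_cases u <;> interval_cases v <;> omega
  · -- k ≥ 2: u² + v² ≥ 100, so max(u,v) ≥ 8 and the (2,1)/(1,2) instance gives D ≥ 1340
    have h100 : 100 ≤ u ^ 2 + v ^ 2 := by
      obtain ⟨k, hk'⟩ := h50
      have : 2 ≤ k := by
        by_contra hc
        push Not at hc
        interval_cases k <;> simp_all
      nlinarith
    rcases le_total v u with hvu | huv
    · have hu8 : 8 ≤ u := by nlinarith
      have : (16 : ℤ) ≤ 2 * (u : ℤ) + v := by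
        have : (8 : ℤ) ≤ u := by exact_mod_cast hu8
        have : (0 : ℤ) ≤ v := by positivity
        linarith
      nlinarith
    · have hv8 : 8 ≤ v := by nlinarith
      have : (16 : ℤ) ≤ (u : ℤ) + 2 * v := by
        have : (8 : ℤ) ≤ v := by exact_mod_cast hv8
        have : (0 : ℤ) ≤ u := by positivity
        linarith
      nlinarith

/-- **WINDOW in scales.**  With `T ≥ D + 2` (N letters from scale 1, P letters below the apex), `T ≥ 1258`. -/
theorem window_scales (x y : ℕ) (D T : ℤ) (h : 5644800 ∣ x ^ 2 + y ^ 2) (hpos : 0 < x ^ 2 + y ^ 2)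
    (c1 : 2 * (x : ℤ) + y ≤ 4 * (1 * D + 2 * 2)) (c2 : (x : ℤ) + 2 * y ≤ 4 * (1 * D + 2 * 2))
    (c3 : 3 * ((x : ℤ) + y) ≤ 4 * (2 * D + 3 * (2 * 1))) (hT : D + 2 ≤ T) : 1258 ≤ T := by
  have := window_exact x y D h hpos c1 c2 c3
  omega

/-- Sharpness bookkeeping: the shape `(2352, 336)` with `D = 1256` satisfies all three instances
`(5040 ≤ 5040, 3024 ≤ 5040, 8064 ≤ 10072)`, so `1256` is the exact value of the bound under these instances. -/
theorem window_exact_sharp :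
    2 * (2352 : ℤ) + 336 ≤ 4 * (1 * 1256 + 2 * 2) ∧ (2352 : ℤ) + 2 * 336 ≤ 4 * (1 * 1256 + 2 * 2) ∧
    3 * ((2352 : ℤ) + 336) ≤ 4 * (2 * 1256 + 3 * (2 * 1)) := by
  refine ⟨?_, ?_, ?_⟩ <;> norm_num

end Summit.HodgeConjecture.HodgeConjecture.Cruxes.BlochSeedDiscOne.SeedChecker.MomentLattice
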